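import Literature.Analysis.FluidPDE.SereginLocalStokesRegularity
import Literature.Analysis.FluidPDE.SpaceTimeMollifier
import Literature.Analysis.FluidPDE.DistributionalPressurePoisson
import HarnessLib

/-!
# Space–time mollification of distributional solutions of the linear Stokes system

Analysis/FluidPDE support file (everything proved, no definitions, no named facts) on the
discharge path of the named fact `Literature.Analysis.FluidPDE.StokesLocalHolderBound`
(`FluidPDE/SereginLocalStokesRegularity`; G. Seregin, *Lecture notes on regularity theory for
the Navier–Stokes equations* (2014), §4.6, Prop. 6.7 followed by Prop. 6.8: the parabolic Hölder
bound for distributional solutions of `∂ₜu - Δu + ∇p = f`, `div u = 0` in the mixed-norm classes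
`L_{s,n}`). The discharge regularises the distributional solution
(`IsDistributionalStokesSolutionOn Q f u p`, (4.6.1)) by space–time mollification — the system is
linear with constant coefficients, so the mollified triple is a *classical* solution in the
interior, to which the potential-theoretic estimates apply pointwise, and one passes to the limit
only at the very end (Seregin 2014, proof of Prop. 6.7: the computation is justified "for
sufficiently smooth functions"; Caffarelli–Kohn–Nirenberg 1982, §2: "the equations hold for the
mollified functions"). With the tree's space–time mollification `k ⋆ 𝟙_Q ·`
(`Fluid.stMollify k (zeroExt Q ·)`, `FluidPDE/SpaceTimeMollifier`) by a smooth kernel `k`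
vanishing off `closedBall 0 r`, at every centre `(t₀, x₀)` with `closedBall (t₀, x₀) r ⊆ Q`:

* `IsDistributionalStokesSolutionOn.integral_pressure_laplacian_add_inner_gradient_eq_zero` —
  **the pressure equation `Δp = div f` in `𝒟'(Q)`**: `∫∫_Q (p Δθ + ⟪f, ∇θ⟫) = 0` for every
  `θ ∈ C_c^∞(Q)` (the momentum equation tested with `ψ = ∇θ`; `∂ₜ∇θ = ∇∂ₜθ` and `Δ∇θ = ∇Δθ`
  pair to zero with the weakly divergence-free `u`, `div ∇θ = Δθ`; Seregin 2014, p. 59: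
  "`Δp = div f`");
* `IsDistributionalStokesSolutionOn.mollified_momentum`, `.mollified_momentum_vec` — **the
  mollified momentum equation** `∂ₜV - ΔV + ∇P = F` at `(t₀, x₀)` for `V = k ⋆ 𝟙_Q u`,
  `P = k ⋆ 𝟙_Q p`, `F = k ⋆ 𝟙_Q f` (componentwise and as vectors);
* `IsDistributionalStokesSolutionOn.divergence_mollified_eq_zero` — `div V = 0` at `(t₀, x₀)`;
* `IsDistributionalStokesSolutionOn.laplacian_mollified_pressure` — **the mollified pressure
  equation** `ΔP = div F` at `(t₀, x₀)`.

(The identity `D_x V = k ⋆ 𝟙_Q G` for a weak spatial gradient `G` is the tree's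
`HasWeakSpatialGradientOn.fderiv_mollified`.)

## References

* G. Seregin, *Lecture notes on regularity theory for the Navier–Stokes equations*, World
  Scientific (2014), §4.6, (4.6.1) and the proof of Prop. 6.7, pp. 58–60. [`Seregin2014`]
* L. Caffarelli, R. Kohn, L. Nirenberg, *Partial regularity of suitable weak solutions of the
  Navier–Stokes equations*, CPAM 35 (1982), §2 (the mollified equations).
  [`CaffarelliKohnNirenberg1982`]
* L. C. Evans, *Partial Differential Equations*, 2nd ed. (2010), App. C.4 and §5.3.1, Thm. 1.
  [`Evans2010`]
-/

noncomputable section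

open MeasureTheory TopologicalSpace Set Function Filter Topology ContinuousLinearMap Metric
  InnerProductSpace
open scoped ENNReal NNReal Convolution Laplacian RealInnerProductSpace ContDiff

namespace Literature.Analysis.FluidPDE

variable {E : Type*} [NormedAddCommGroup E] [InnerProductSpace ℝ E] [FiniteDimensional ℝ E]
  [MeasurableSpace E] [BorelSpace E]

/-! ### The pressure equation in the sense of distributions -/

section Pressure

variable {Q : Opens (ℝ × E)} {f u : ℝ → E → E} {p : ℝ → E → ℝ}

/-- **The pressure equation `Δp = div f` in `𝒟'(Q)` of a distributional Stokes solution**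
(Seregin 2014, §4.6, proof of Prop. 6.7, p. 59: taking the divergence of
`∂ₜu - Δu = f - ∇p`, `div u = 0`): for every `θ ∈ C_c^∞(Q)`,
`∫∫_Q (p Δθ + ⟪f, ∇θ⟫) = 0`. Proof: the momentum identity tested with the gradient field
`ψ = ∇θ`; there `∂ₜψ = ∇∂ₜθ` and `Δψ = ∇Δθ` pair to zero with the weakly divergence-free `u`
(`∂ₜθ`, `Δθ` being test functions on `Q`), and `div ψ = Δθ`. [cite: Seregin2014, §4.6 proof of Prop. 6.7 (p. 59)] -/
theorem IsDistributionalStokesSolutionOn.integral_pressure_laplacian_add_inner_gradient_eq_zero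
    (h : IsDistributionalStokesSolutionOn Q f u p) {θ : ℝ → E → ℝ} (hθ : IsSpaceTimeTestOn Q θ) :
    ∫ z in (Q : Set (ℝ × E)), (p z.1 z.2 * Δ (θ z.1) z.2 + ⟪f z.1 z.2, gradient (θ z.1) z.2⟫) =
      0 := by
  obtain ⟨hu, -, -, hdiv, hmom⟩ := h
  -- the gradient test field and the derived scalar tests
  have hψ := hθ.gradient_isSpaceTimeTestOn
  have h1 := hθ.timeDeriv_isSpaceTimeTestOn
  have h2 := hθ.laplacian_isSpaceTimeTestOn
  have hθ2 : ∀ t, ContDiff ℝ 2 (θ t) := fun t => contDiff_infty.1 (hθ.contDiff_slice t) 2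
  have hθ3 : ∀ t, ContDiff ℝ 3 (θ t) := fun t => contDiff_infty.1 (hθ.contDiff_slice t) 3
  -- the momentum equation against `ψ = ∇θ`, rewritten pointwise
  have key := hmom _ hψ
  have hpt : ∀ z : ℝ × E,
      ⟪u z.1 z.2, timeDeriv (fun s y => gradient (θ s) y) z.1 z.2⟫ +
        ⟪u z.1 z.2, Δ (fun y => gradient (θ z.1) y) z.2⟫ +
        p z.1 z.2 * VectorCalculus.divergence (fun y => gradient (θ z.1) y) z.2 +
        ⟪f z.1 z.2, gradient (θ z.1) z.2⟫ =
      (p z.1 z.2 * Δ (θ z.1) z.2 + ⟪f z.1 z.2, gradient (θ z.1) z.2⟫) +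
        (⟪u z.1 z.2, gradient (timeDeriv θ z.1) z.2⟫ +
          ⟪u z.1 z.2, gradient (fun y => Δ (θ z.1) y) z.2⟫) := by
    rintro ⟨t, x⟩
    have e1 : timeDeriv (fun s y => gradient (θ s) y) t x = gradient (timeDeriv θ t) x :=
      hθ.timeDeriv_gradient t x
    have e3 : Δ (fun y => gradient (θ t) y) x = gradient (fun y => Δ (θ t) y) x :=
      laplacian_gradient (hθ3 t) x
    have e4 : VectorCalculus.divergence (fun y => gradient (θ t) y) x = Δ (θ t) x :=
      divergence_gradient (hθ2 t) x
    simp only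
    rw [e1, e3, e4]
    ring
  simp_rw [hpt] at key
  -- the two extra terms are integrable on `Q` and integrate to zero
  obtain ⟨c1, -, z1⟩ := h1.continuous_gradient_field
  obtain ⟨c2, -, z2⟩ := h2.continuous_gradient_field
  have hK1 : tsupport (uncurry (timeDeriv θ)) ⊆ (Q : Set (ℝ × E)) := h1.tsupport_subset
  have hK2 : tsupport (uncurry fun t => Δ (θ t)) ⊆ (Q : Set (ℝ × E)) := h2.tsupport_subset
  have I1 : Integrable (fun z : ℝ × E => ⟪u z.1 z.2, gradient (timeDeriv θ z.1) z.2⟫)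
      (volume : Measure (ℝ × E)) :=
    integrable_inner_of_locallyIntegrableOn hu c1 h1.hasCompactSupport hK1 z1
  have I2 : Integrable (fun z : ℝ × E => ⟪u z.1 z.2, gradient (fun y => Δ (θ z.1) y) z.2⟫)
      (volume : Measure (ℝ × E)) :=
    integrable_inner_of_locallyIntegrableOn hu c2 h2.hasCompactSupport hK2 z2
  have hg : Integrable (fun z : ℝ × E => ⟪u z.1 z.2, gradient (timeDeriv θ z.1) z.2⟫ +
      ⟪u z.1 z.2, gradient (fun y => Δ (θ z.1) y) z.2⟫)
      ((volume : Measure (ℝ × E)).restrict (Q : Set (ℝ × E))) :=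
    I1.integrableOn.add I2.integrableOn
  have hg0 : ∫ z in (Q : Set (ℝ × E)), (⟪u z.1 z.2, gradient (timeDeriv θ z.1) z.2⟫ +
      ⟪u z.1 z.2, gradient (fun y => Δ (θ z.1) y) z.2⟫) = 0 := by
    rw [integral_add I1.integrableOn I2.integrableOn, hdiv _ h1, hdiv _ h2, add_zero]
  -- subtract them
  have hsub := integral_sub_eq_self_of_integral_eq_zero
    (F := fun z : ℝ × E =>
      (p z.1 z.2 * Δ (θ z.1) z.2 + ⟪f z.1 z.2, gradient (θ z.1) z.2⟫) +
        (⟪u z.1 z.2, gradient (timeDeriv θ z.1) z.2⟫ +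
          ⟪u z.1 z.2, gradient (fun y => Δ (θ z.1) y) z.2⟫)) hg hg0
  rw [key] at hsub
  simp only [add_sub_cancel_right] at hsub
  exact hsub

end Pressure

/-! ### The mollified Stokes system holds pointwise in the interior -/

section Mollified

variable {Q : Opens (ℝ × E)} {f u : ℝ → E → E} {p : ℝ → E → ℝ}
variable {k : ℝ × E → ℝ} {r t₀ : ℝ} {x₀ : E}

/-- **The mollified momentum equation, componentwise.** Let `(u, p)` be a distributional
solution of the Stokes system with force `f` on an open `Q ⊆ ℝ × E`
(`IsDistributionalStokesSolutionOn`) with `u`, `p`, `f` integrable on `Q`; let `k` be a `C^∞`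
kernel vanishing outside `closedBall 0 r` and `closedBall (t₀, x₀) r ⊆ Q`. Then
`V = k ⋆ 𝟙_Q u`, `P = k ⋆ 𝟙_Q p`, `F = k ⋆ 𝟙_Q f` satisfy, for every `e`,
`⟪∂ₜV, e⟫ - ⟪ΔV, e⟫ + ∂ₑP = ⟪F, e⟫` at `(t₀, x₀)` — the distributional identity tested with
`ψ = k((t₀, x₀) - ·) e` (Caffarelli–Kohn–Nirenberg 1982, §2: "the equations hold for the
mollified functions"; Seregin 2014, §4.6 (4.6.1)). [cite: Seregin2014, §4.6 (4.6.1); CaffarelliKohnNirenberg1982, §2] -/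
theorem IsDistributionalStokesSolutionOn.mollified_momentum
    (h : IsDistributionalStokesSolutionOn Q f u p)
    (hu : IntegrableOn (uncurry u) (Q : Set (ℝ × E)) volume)
    (hp : IntegrableOn (uncurry p) (Q : Set (ℝ × E)) volume)
    (hf : IntegrableOn (uncurry f) (Q : Set (ℝ × E)) volume)
    (hk : ContDiff ℝ ∞ k) (hkr : ∀ w, w ∉ closedBall (0 : ℝ × E) r → k w = 0)
    (hQ : closedBall ((t₀, x₀) : ℝ × E) r ⊆ Q) (e : E) :
    ⟪timeDeriv (stMollify k (zeroExt Q u)) t₀ x₀, e⟫ -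
      ⟪(Δ (stMollify k (zeroExt Q u) t₀)) x₀, e⟫ +
      fderiv ℝ (stMollify k (zeroExt Q p) t₀) x₀ e =
      ⟪stMollify k (zeroExt Q f) t₀ x₀, e⟫ := by
  -- Lebesgue measure on `ℝ × E` is a Haar measure (product instance, not found through `volume`)
  haveI : (volume : Measure (ℝ × E)).IsAddHaarMeasure := Measure.prod.instIsAddHaarMeasure _ _
  -- the kernels
  set k₁ : ℝ × E → ℝ := fun w => fderiv ℝ k w (1, 0) with hk₁
  set kₑ : ℝ × E → ℝ := fun w => fderiv ℝ k w (0, e) with hkₑ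
  have hkc : HasCompactSupport k := hasCompactSupport_of_closedBall hkr
  have hk1 : ContDiff ℝ 1 k := hk.of_le one_le_infty
  have hkd : Differentiable ℝ k := hk1.differentiable one_ne_zero
  have hk₁c : Continuous k₁ := (contDiff_fderiv_apply_const hk _).continuous
  have hkₑc : Continuous kₑ := (contDiff_fderiv_apply_const hk _).continuous
  have hkΔc : Continuous (spaceLaplacian k) := (contDiff_spaceLaplacian hk).continuous
  have hk₁r := fderiv_apply_eq_zero_of_closedBall hkr ((1 : ℝ), (0 : E))
  have hkₑr := fderiv_apply_eq_zero_of_closedBall hkr ((0 : ℝ), e)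
  have hkΔr := spaceLaplacian_eq_zero_of_closedBall hk hkr
  obtain ⟨C₀, hC₀⟩ := exists_bound_of_closedBall hk.continuous hkr
  obtain ⟨C₁, hC₁⟩ := exists_bound_of_closedBall hk₁c hk₁r
  obtain ⟨Cₑ, hCₑ⟩ := exists_bound_of_closedBall hkₑc hkₑr
  obtain ⟨CΔ, hCΔ⟩ := exists_bound_of_closedBall hkΔc hkΔr
  -- zero extensions
  have hQm : MeasurableSet (Q : Set (ℝ × E)) := Q.isOpen.measurableSet
  have huE : LocallyIntegrable (zeroExt Q u) volume := locallyIntegrable_zeroExt hu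
  have hpE : LocallyIntegrable (zeroExt Q p) volume := locallyIntegrable_zeroExt hp
  have hfE : LocallyIntegrable (zeroExt Q f) volume := locallyIntegrable_zeroExt hf
  -- the test field `ψ = k(z₀ - ·) e`
  set θ : ℝ → E → ℝ := reflect k t₀ x₀ with hθ_def
  have hθ : IsSpaceTimeTestOn Q θ := isSpaceTimeTestOn_reflect hk hkr hQ
  set ψ : ℝ → E → E := fun s y => θ s y • e with hψ_def
  have hψ : IsSpaceTimeTestOn Q ψ := isSpaceTimeTestOn_reflect_smul hk hkr hQ e
  have key := h.momentum hψ
  -- the four integrands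
  set A : ℝ × E → ℝ := fun z => k₁ ((t₀, x₀) - z) * ⟪u z.1 z.2, e⟫ with hA
  set Cc : ℝ × E → ℝ := fun z => spaceLaplacian k ((t₀, x₀) - z) * ⟪u z.1 z.2, e⟫ with hCc
  set D : ℝ × E → ℝ := fun z => kₑ ((t₀, x₀) - z) * p z.1 z.2 with hD
  set Ff : ℝ × E → ℝ := fun z => k ((t₀, x₀) - z) * ⟪f z.1 z.2, e⟫ with hFf
  have hpt : ∀ z : ℝ × E, (⟪u z.1 z.2, timeDeriv ψ z.1 z.2⟫ + ⟪u z.1 z.2, (Δ (ψ z.1)) z.2⟫ +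
      p z.1 z.2 * VectorCalculus.divergence (ψ z.1) z.2 + ⟪f z.1 z.2, ψ z.1 z.2⟫) =
      -A z + Cc z - D z + Ff z := by
    rintro ⟨s, y⟩
    have hθd : DifferentiableAt ℝ (θ s) y :=
      ((IsSpaceTimeTestOn.contDiff_slice hθ s).differentiable (by simp)) y
    have hθt : DifferentiableAt ℝ (fun s => θ s y) s :=
      (IsSpaceTimeTestOn.hasDerivAt_time hθ s y).differentiableAt
    have hθ2 : ContDiff ℝ 2 (θ s) := IsSpaceTimeTestOn.contDiff_slice_two hθ s
    have e1 : timeDeriv ψ s y = (-k₁ (t₀ - s, x₀ - y)) • e := by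
      rw [hψ_def, timeDeriv_smul_const θ e hθt, hθ_def, timeDeriv_reflect hkd]
    have e3 : (Δ (ψ s)) y = spaceLaplacian k (t₀ - s, x₀ - y) • e := by
      rw [hψ_def]
      change (Δ (fun y => θ s y • e)) y = _
      rw [laplacian_smul_const hθ2, hθ_def, laplacian_reflect (hk.of_le two_le_infty)]
    have e4 : VectorCalculus.divergence (ψ s) y = -kₑ (t₀ - s, x₀ - y) := by
      rw [hψ_def]
      change VectorCalculus.divergence (fun y => θ s y • e) y = _
      rw [divergence_smul_const e hθd, hθ_def, fderiv_reflect_apply hkd]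
    have e5 : ψ s y = k (t₀ - s, x₀ - y) • e := rfl
    simp only [e1, e3, e4, e5, hA, hCc, hD, hFf, real_inner_smul_right, Prod.mk_sub_mk]
    ring
  -- integrability of the four integrands on `Q`
  have hue : Integrable (fun z : ℝ × E => ⟪u z.1 z.2, e⟫) (volume.restrict (Q : Set (ℝ × E))) :=
    hu.inner_const (𝕜 := ℝ) e
  have hfe : Integrable (fun z : ℝ × E => ⟪f z.1 z.2, e⟫) (volume.restrict (Q : Set (ℝ × E))) :=
    hf.inner_const (𝕜 := ℝ) e
  have hcont : ∀ {c : ℝ × E → ℝ}, Continuous c →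
      AEStronglyMeasurable (fun z : ℝ × E => c ((t₀, x₀) - z))
        (volume.restrict (Q : Set (ℝ × E))) := fun hc =>
    (hc.comp (continuous_const.sub continuous_id)).aestronglyMeasurable
  have hAi : Integrable A (volume.restrict (Q : Set (ℝ × E))) :=
    hue.bdd_mul (hcont hk₁c) (Eventually.of_forall fun z => hC₁ _)
  have hCi : Integrable Cc (volume.restrict (Q : Set (ℝ × E))) :=
    hue.bdd_mul (hcont hkΔc) (Eventually.of_forall fun z => hCΔ _)
  have hDi : Integrable D (volume.restrict (Q : Set (ℝ × E))) :=
    hp.bdd_mul (hcont hkₑc) (Eventually.of_forall fun z => hCₑ _)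
  have hFi : Integrable Ff (volume.restrict (Q : Set (ℝ × E))) :=
    hfe.bdd_mul (hcont hk.continuous) (Eventually.of_forall fun z => hC₀ _)
  -- split the distributional identity
  have hsplit : ∫ z in (Q : Set (ℝ × E)), (-A z + Cc z - D z + Ff z) =
      -(∫ z in (Q : Set (ℝ × E)), A z) + (∫ z in (Q : Set (ℝ × E)), Cc z) -
        (∫ z in (Q : Set (ℝ × E)), D z) + ∫ z in (Q : Set (ℝ × E)), Ff z := by
    have i4 : Integrable (fun z => -A z) (volume.restrict (Q : Set (ℝ × E))) := hAi.neg
    have i2 : Integrable (fun z => -A z + Cc z) (volume.restrict (Q : Set (ℝ × E))) := i4.add hCi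
    have i1 : Integrable (fun z => -A z + Cc z - D z) (volume.restrict (Q : Set (ℝ × E))) :=
      i2.sub hDi
    rw [integral_add i1 hFi, integral_sub i2 hDi, integral_add i4 hCi, integral_neg]
  rw [setIntegral_congr_fun hQm (fun z _ => hpt z), hsplit] at key
  -- identify the four terms
  have hexu : ∀ {c : ℝ × E → ℝ}, Continuous c → (∀ w, w ∉ closedBall (0 : ℝ × E) r → c w = 0) →
      ConvolutionExistsAt c (zeroExt Q u) (t₀, x₀) (lsmul ℝ ℝ) volume := fun hc hcr =>
    (hasCompactSupport_of_closedBall hcr).convolutionExists_left _ hc huE _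
  have hexf : ConvolutionExistsAt k (zeroExt Q f) (t₀, x₀) (lsmul ℝ ℝ) volume :=
    (hasCompactSupport_of_closedBall hkr).convolutionExists_left _ hk.continuous hfE _
  have iA : ⟪timeDeriv (stMollify k (zeroExt Q u)) t₀ x₀, e⟫ = ∫ z in (Q : Set (ℝ × E)), A z := by
    rw [timeDeriv_stMollify hk hkc huE, stMollify_apply, inner_convolution_lsmul_apply (hexu hk₁c hk₁r),
      convolution_lsmul_apply_eq]
    simp_rw [inner_zeroExt_left]
    rw [← setIntegral_smul_eq_integral_zeroExt]
    rfl
  have iC : ⟪(Δ (stMollify k (zeroExt Q u) t₀)) x₀, e⟫ = ∫ z in (Q : Set (ℝ × E)), Cc z := by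
    rw [laplacian_stMollify hk hkc huE, stMollify_apply, inner_convolution_lsmul_apply (hexu hkΔc hkΔr),
      convolution_lsmul_apply_eq]
    simp_rw [inner_zeroExt_left]
    rw [← setIntegral_smul_eq_integral_zeroExt]
    rfl
  have iD : fderiv ℝ (stMollify k (zeroExt Q p) t₀) x₀ e = ∫ z in (Q : Set (ℝ × E)), D z := by
    rw [fderiv_stMollify_apply hk hkc hpE, stMollify_eq_integral,
      ← setIntegral_smul_eq_integral_zeroExt]
    rfl
  have iF : ⟪stMollify k (zeroExt Q f) t₀ x₀, e⟫ = ∫ z in (Q : Set (ℝ × E)), Ff z := by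
    rw [stMollify_apply, inner_convolution_lsmul_apply hexf, convolution_lsmul_apply_eq]
    simp_rw [inner_zeroExt_left]
    rw [← setIntegral_smul_eq_integral_zeroExt]
    rfl
  rw [iA, iC, iD, iF]
  linarith

/-- **The mollified momentum equation, vector form**: under the hypotheses of
`mollified_momentum`, `∂ₜV - ΔV + ∇P = F` at `(t₀, x₀)` for `V = k ⋆ 𝟙_Q u`, `P = k ⋆ 𝟙_Q p`,
`F = k ⋆ 𝟙_Q f` (Seregin 2014, (4.6.1), for the regularised triple). [cite: Seregin2014, §4.6 (4.6.1); CaffarelliKohnNirenberg1982, §2] -/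
theorem IsDistributionalStokesSolutionOn.mollified_momentum_vec
    (h : IsDistributionalStokesSolutionOn Q f u p)
    (hu : IntegrableOn (uncurry u) (Q : Set (ℝ × E)) volume)
    (hp : IntegrableOn (uncurry p) (Q : Set (ℝ × E)) volume)
    (hf : IntegrableOn (uncurry f) (Q : Set (ℝ × E)) volume)
    (hk : ContDiff ℝ ∞ k) (hkr : ∀ w, w ∉ closedBall (0 : ℝ × E) r → k w = 0)
    (hQ : closedBall ((t₀, x₀) : ℝ × E) r ⊆ Q) :
    timeDeriv (stMollify k (zeroExt Q u)) t₀ x₀ - (Δ (stMollify k (zeroExt Q u) t₀)) x₀ +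
      gradient (stMollify k (zeroExt Q p) t₀) x₀ = stMollify k (zeroExt Q f) t₀ x₀ := by
  refine ext_inner_right ℝ fun e => ?_
  have key := h.mollified_momentum hu hp hf hk hkr hQ e
  rw [inner_add_left, inner_sub_left, real_inner_comm e (gradient _ _),
    inner_gradient_right_eq_fderiv]
  exact key

/-- **The mollified velocity is divergence free**: `div_x (k ⋆ 𝟙_Q u) = 0` at `(t₀, x₀)` (only
the weak divergence-free condition and the integrability of `u` on `Q` are used; the test
function is `θ = k((t₀, x₀) - ·)`). [cite: Seregin2014, §4.6 (4.6.1); CaffarelliKohnNirenberg1982, §2] -/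
theorem IsDistributionalStokesSolutionOn.divergence_mollified_eq_zero
    (h : IsDistributionalStokesSolutionOn Q f u p)
    (hu : IntegrableOn (uncurry u) (Q : Set (ℝ × E)) volume)
    (hk : ContDiff ℝ ∞ k) (hkr : ∀ w, w ∉ closedBall (0 : ℝ × E) r → k w = 0)
    (hQ : closedBall ((t₀, x₀) : ℝ × E) r ⊆ Q) :
    VectorCalculus.divergence (stMollify k (zeroExt Q u) t₀) x₀ = 0 := by
  haveI : (volume : Measure (ℝ × E)).IsAddHaarMeasure := Measure.prod.instIsAddHaarMeasure _ _
  have hkc : HasCompactSupport k := hasCompactSupport_of_closedBall hkr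
  have hkd : Differentiable ℝ k := (hk.of_le one_le_infty).differentiable one_ne_zero
  have hQm : MeasurableSet (Q : Set (ℝ × E)) := Q.isOpen.measurableSet
  have huE : LocallyIntegrable (zeroExt Q u) volume := locallyIntegrable_zeroExt hu
  have hθ : IsSpaceTimeTestOn Q (reflect k t₀ x₀) := isSpaceTimeTestOn_reflect hk hkr hQ
  have key := h.divFree hθ
  have hpt : ∀ z : ℝ × E, ⟪u z.1 z.2, gradient (reflect k t₀ x₀ z.1) z.2⟫ =
      -fderiv ℝ k ((t₀, x₀) - z) (0, u z.1 z.2) := by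
    rintro ⟨s, y⟩
    rw [inner_gradient_right_eq_fderiv, fderiv_reflect_apply hkd, Prod.mk_sub_mk]
  rw [setIntegral_congr_fun hQm (fun z _ => hpt z), integral_neg, neg_eq_zero,
    ← integral_indicator hQm] at key
  rw [divergence_stMollify hk hkc huE]
  refine Eq.trans (integral_congr_ae (Eventually.of_forall fun z => ?_)) key
  dsimp only
  by_cases hz : z ∈ (Q : Set (ℝ × E))
  · rw [indicator_of_mem hz, zeroExt_of_mem _ hz]
  · rw [indicator_of_notMem hz, zeroExt_of_not_mem _ hz, Prod.mk_zero_zero, map_zero]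

/-- **The mollified pressure equation** `Δ_x (k ⋆ 𝟙_Q p) = div_x (k ⋆ 𝟙_Q f)` at `(t₀, x₀)`
(the distributional pressure equation `∫∫_Q (p Δθ + ⟪f, ∇θ⟫) = 0` tested with
`θ = k((t₀, x₀) - ·)`; Seregin 2014, proof of Prop. 6.7, p. 59: "`Δp = div f`"). [cite: Seregin2014, §4.6 proof of Prop. 6.7 (p. 59)] -/
theorem IsDistributionalStokesSolutionOn.laplacian_mollified_pressure
    (h : IsDistributionalStokesSolutionOn Q f u p)
    (hp : IntegrableOn (uncurry p) (Q : Set (ℝ × E)) volume)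
    (hf : IntegrableOn (uncurry f) (Q : Set (ℝ × E)) volume)
    (hk : ContDiff ℝ ∞ k) (hkr : ∀ w, w ∉ closedBall (0 : ℝ × E) r → k w = 0)
    (hQ : closedBall ((t₀, x₀) : ℝ × E) r ⊆ Q) :
    (Δ (stMollify k (zeroExt Q p) t₀)) x₀ =
      VectorCalculus.divergence (stMollify k (zeroExt Q f) t₀) x₀ := by
  haveI : (volume : Measure (ℝ × E)).IsAddHaarMeasure := Measure.prod.instIsAddHaarMeasure _ _
  have hkc : HasCompactSupport k := hasCompactSupport_of_closedBall hkr
  have hk1 : ContDiff ℝ 1 k := hk.of_le one_le_infty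
  have hkd : Differentiable ℝ k := hk1.differentiable one_ne_zero
  have hkΔc : Continuous (spaceLaplacian k) := (contDiff_spaceLaplacian hk).continuous
  have hkΔr := spaceLaplacian_eq_zero_of_closedBall hk hkr
  obtain ⟨CΔ, hCΔ⟩ := exists_bound_of_closedBall hkΔc hkΔr
  obtain ⟨CD, hCD⟩ := (hk.continuous_fderiv (by simp)).bounded_above_of_compact_support
    (hkc.fderiv ℝ)
  have hQm : MeasurableSet (Q : Set (ℝ × E)) := Q.isOpen.measurableSet
  have hpE : LocallyIntegrable (zeroExt Q p) volume := locallyIntegrable_zeroExt hp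
  have hfE : LocallyIntegrable (zeroExt Q f) volume := locallyIntegrable_zeroExt hf
  have hθ : IsSpaceTimeTestOn Q (reflect k t₀ x₀) := isSpaceTimeTestOn_reflect hk hkr hQ
  have key := h.integral_pressure_laplacian_add_inner_gradient_eq_zero hθ
  -- the two integrands
  set A : ℝ × E → ℝ := fun z => p z.1 z.2 * spaceLaplacian k ((t₀, x₀) - z) with hA
  set B : ℝ × E → ℝ := fun z => fderiv ℝ k ((t₀, x₀) - z) (0, f z.1 z.2) with hB
  have hpt : ∀ z : ℝ × E, p z.1 z.2 * Δ (reflect k t₀ x₀ z.1) z.2 +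
      ⟪f z.1 z.2, gradient (reflect k t₀ x₀ z.1) z.2⟫ = A z - B z := by
    rintro ⟨s, y⟩
    rw [inner_gradient_right_eq_fderiv, fderiv_reflect_apply hkd,
      laplacian_reflect (hk.of_le two_le_infty)]
    simp only [hA, hB, Prod.mk_sub_mk]
    ring
  -- integrability
  have hmf : AEStronglyMeasurable (uncurry f) (volume.restrict (Q : Set (ℝ × E))) :=
    hf.aestronglyMeasurable
  have hAi : Integrable A (volume.restrict (Q : Set (ℝ × E))) :=
    hp.mul_bdd ((hkΔc.comp (continuous_const.sub continuous_id)).aestronglyMeasurable)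
      (Eventually.of_forall fun z => hCΔ _)
  have hCD0 : 0 ≤ CD := (norm_nonneg _).trans (hCD 0)
  have hBi : Integrable B (volume.restrict (Q : Set (ℝ × E))) := by
    refine Integrable.mono' (hf.norm.const_mul CD) ?_ (Eventually.of_forall fun z => ?_)
    · exact aestronglyMeasurable_fderiv_sub_apply hk1 _ hmf
    · rw [hB]
      refine (le_opNorm _ _).trans (mul_le_mul (hCD _) ?_ (norm_nonneg _) hCD0)
      simp [Prod.norm_def, uncurry]
  rw [setIntegral_congr_fun hQm (fun z _ => hpt z), integral_sub hAi hBi, sub_eq_zero] at key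
  -- identify the two sides
  have lhs : (Δ (stMollify k (zeroExt Q p) t₀)) x₀ = ∫ z in (Q : Set (ℝ × E)), A z := by
    rw [laplacian_stMollify hk hkc hpE, stMollify_eq_integral, ← setIntegral_smul_eq_integral_zeroExt]
    refine integral_congr_ae (Eventually.of_forall fun z => ?_)
    simp only [hA, smul_eq_mul, mul_comm]
  have rhs : VectorCalculus.divergence (stMollify k (zeroExt Q f) t₀) x₀ =
      ∫ z in (Q : Set (ℝ × E)), B z := by
    rw [divergence_stMollify hk hkc hfE, ← integral_indicator hQm]
    refine integral_congr_ae (Eventually.of_forall fun z => ?_)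
    dsimp only
    by_cases hz : z ∈ (Q : Set (ℝ × E))
    · rw [indicator_of_mem hz, zeroExt_of_mem _ hz]
    · rw [indicator_of_notMem hz, zeroExt_of_not_mem _ hz, Prod.mk_zero_zero, map_zero]
  rw [lhs, rhs, key]

end Mollified

end Literature.Analysis.FluidPDE

end
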